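/-
Copyright (c) 2026. Released under Apache 2.0 license.
-/
import Literature.NumberTheory.EllipticCurves.ModularCurveEtaQuotientsCharacterProofs
import Literature.NumberTheory.EllipticCurves.XZeroThirtyTwoEtaQuotientSqrtX
import Literature.NumberTheory.EllipticCurves.WeightOneEtaQuotientsProofs
import Literature.NumberTheory.ModularForms.DombEtaQuotientCMSigns
import HarnessLib

/-!
# The level-`32` `η`-quotient `s = η(16τ)³/(η(8τ)η(32τ)²)` — a square root of the coordinate
# `x_η = η(16τ)⁶/(η(8τ)²η(32τ)⁴)` of `X₀(32) ≅ A : y² = x³ + 4x` — has character `(2/·)` on `Γ₀(32)` (PROOFS)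

Topic `Literature/NumberTheory/EllipticCurves`; namespace
`Literature.NumberTheory.EllipticCurves.ModularForms` (proof companion of `XZeroThirtyTwoEtaQuotientSqrtX`,
which defines the exponent vector `rS`; sequel of `ModularCurveEtaQuotientsCharacterProofs`). Cell `bsd-print-cf2`, typer seat `-ty2` (g51), the INSTANCE half of
deliverable **(A1)** of the pen's SUMMON 2026-08-31T03:11:49Z for crux `stmt-BirchSwinnertonDyer-20509`
(THEOREM A, stub `stub_offTYZ_firstNormSquare_R2` of skeleton v10; LEAD memo `Lines/offtyz_v7_ExactDescent.md`
§2a: «`x = s²`, `s := η(16τ)³/(η(8τ)η(32τ)²) = q⁻¹∏(1−q^{16m})³(1−q^{8m})⁻¹(1−q^{32m})⁻²`, an η-quotient of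
weight 0 and level 32 with `Σ δ r_δ = −24`, `Σ (32/δ) r_δ = 0`, `∏ δ^{r_δ} = 1/2` NOT a square: by the
η-quotient criterion `s(γτ) = (2/d)·s(τ)` for `γ ∈ Γ₀(32)`»). THEOREMS ONLY, all proved; no definition, no named fact, no
instance, no notation.

* `rX_eq_two_mul_rS` and **`etaQuotient_rX_eq_sq` (`x_η = s²`)** (the Newman data of `rS` — `Σ r_δ = 0`,
  `Σ δ r_δ = −24`, `Σ (32/δ) r_δ = 0`, `∏ δ^{|r_δ|} = 2²⁵`, `cuspOrder24_rS` — are `decide`d in the statement file);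
* **`etaQuotient_rS_smul` — `s(γτ) = χ₈(d)·s(τ) = (2/|d|)·s(τ)` for every `γ = (a b; c d) ∈ Γ₀(32)`**
  (Savitt 2025 Thm. 1 via `etaQuotient_smul_of_mem_Gamma0_char` at `N = 32`, `k = 0`, character value
  `(2²⁵/|d|) = χ₈(d)` by `jacobiSym_two_pow_mul`), slash form `etaQuotient_rS_slash`; hence invariance on
  `Γ′ = {γ ∈ Γ₀(32) : d ≡ ±1 (mod 8)}` (`etaQuotient_rS_smul_of_chi_eq_one`), on `Γ₁(32)`
  (`etaQuotient_rS_smul_of_mem_Gamma1`) and on `Γ(32)` (`etaQuotient_rS_smul_of_mem_Gamma`), and the sign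
  change under `d ≡ ±3 (mod 8)` (`etaQuotient_rS_smul_of_chi_eq_neg_one`);
* the analytic data a «modular function of level 32» predicate asks for: holomorphy and non-vanishing on `ℍ`
  (`mdifferentiable_etaQuotient_rS`, `etaQuotient_rS_ne_zero`), the leading term `q·s → 1`
  (`tendsto_etaQuotient_rS`), the lower bound `cuspOrder24 32 rS c ≥ −768` at every cusp
  (`neg_le_cuspOrder24_rS`), **`q·(s ∣[0] γ)`
  bounded at `i∞` for EVERY `γ ∈ SL₂(ℤ)`** (`isBoundedAtImInfty_qParam_mul_etaQuotient_rS_slash`, from the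
  general `isBoundedAtImInfty_qParam_pow_mul_etaQuotient_slash`: `qⁿ·(f ∣[k] γ)` is bounded as soon as
  `24Nn + cuspOrder24 N r c ≥ 0`), and the **integral `q`-expansion `q·s(τ) = ∏(1−q^{16m})³(1−q^{8m})⁻¹(1−q^{32m})⁻²
  ∈ 1 + qℤ⟦q⟧`** (`qParam_mul_etaQuotient_rS_eq_eulerUnit`, `isIntUnitQExp_qParam_mul_etaQuotient_rS`,
  `hasSum_qParam_mul_etaQuotient_rS`).

NOT proved here (prover work, as for `x_η` in the g47 file): the identity of `s²` with the coordinate `x` of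
`A` pulled back along the modular parametrisation `X₀(32) → A`.

## References

* D. Savitt, *An elementary proof of Newman's eta-quotient theorem*, Res. Number Theory 11 (2025),
  arXiv:2507.16225 — Thm. 1, Rem. 2. [Savitt2025]
* G. Ligozat, *Courbes modulaires de genre 1*, Mém. SMF 43 (1975), Prop. 3.2.1, Prop. 3.2.8. [Ligozat1975]
* Y. Tian, X. Yuan, S. Zhang, *Genus periods, genus points and congruent number problem*, Asian J. Math. 21
  (2017), §3.2 (`i₀ : X₀(32) ≅ A`). [TianYuanZhang2017]
-/

noncomputable section

open UpperHalfPlane hiding I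
open ModularForm Complex Matrix.SpecialLinearGroup Filter Asymptotics CongruenceSubgroup
open scoped MatrixGroups Real ModularForm CongruenceSubgroup Topology Manifold NumberTheorySymbols

namespace Literature.NumberTheory.EllipticCurves.ModularForms

open Literature.NumberTheory.ModularForms (eulerUnit etaQuotient_eq_cexp_mul_eulerUnit
  isIntUnitQExp_eulerUnit eulerUnit_ne_zero)

/-! ## `x_η = s²` -/

/-- `rX = 2·rS`: `x_η = s²` on exponent vectors. [cite: Ligozat1975, Prop. 3.2.1] -/
theorem rX_eq_two_mul_rS : rX = fun δ => 2 * rS δ := by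
  funext δ
  simp only [rX, rS]
  split_ifs <;> rfl

/-- **`x_η = s²`**: `η(16τ)⁶/(η(8τ)²η(32τ)⁴) = (η(16τ)³/(η(8τ)η(32τ)²))²`.
[cite: Ligozat1975, Prop. 3.2.1] -/
theorem etaQuotient_rX_eq_sq (τ : ℍ) : etaQuotient 32 rX τ = etaQuotient 32 rS τ ^ 2 := by
  rw [etaQuotient_apply, etaQuotient_apply, rX_eq_two_mul_rS, ← Finset.prod_pow]
  refine Finset.prod_congr rfl fun δ _ ↦ ?_
  simp only
  rw [show (2 : ℤ) * rS δ = rS δ * ((2 : ℕ) : ℤ) by push_cast; ring, zpow_mul, zpow_natCast]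

/-! ## The character `(2/·)` on `Γ₀(32)` -/

/-- The character value of Newman's theorem for `rS`: `(2²⁵/|d|) = χ₈(d)` for odd `d`.
[cite: Savitt2025, Thm. 1] -/
theorem newmanChar_rS {d : ℤ} (hd : Odd d) :
    J(((∏ δ ∈ Nat.divisors 32, δ ^ (rS δ).natAbs : ℕ) : ℤ) | d.natAbs) = ZMod.χ₈ (d : ZMod 8) := by
  rw [rS_prod_pow_natAbs, show (2 ^ 25 : ℕ) = 2 ^ 25 * 1 from (mul_one _).symm,
    jacobiSym_two_pow_mul (by decide) hd, jacobiSym.one_right, mul_one, Nat.cast_one,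
    show recipSign 1 d = 1 by simp [recipSign], mul_one,
    show (25 : ℕ) = 2 * 12 + 1 by norm_num, pow_add, pow_mul, χ₈_int_sq_of_odd hd, one_pow,
    one_mul, pow_one]

/-- **`s(γτ) = χ₈(d)·s(τ) = (2/|d|)·s(τ)` for every `γ = (a b; c d) ∈ Γ₀(32)`** — Newman's theorem
with character (Savitt 2025, Thm. 1) at `N = 32`, `k = 0`: `s` is a weight-`0` form on `Γ₀(32)` with
the even quadratic character `(2/·)` of conductor `8`. [cite: Savitt2025, Thm. 1] -/
theorem etaQuotient_rS_smul {γ : SL(2, ℤ)} (hγ : γ ∈ Gamma0 32) (τ : ℍ) :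
    etaQuotient 32 rS (γ • τ) = (ZMod.χ₈ ((γ 1 1 : ℤ) : ZMod 8) : ℂ) * etaQuotient 32 rS τ := by
  have hd : Odd (γ 1 1) := odd_d_of_mem_Gamma0_of_even (by decide) hγ
  have h := etaQuotient_smul_of_mem_Gamma0_char 32 (by norm_num) (by decide) rS 0 ⟨0, rfl⟩ rS_sum
    (by decide) (by decide) hγ τ
  rw [newmanChar_rS hd, zpow_zero, mul_one] at h
  exact h

/-- Slash form: `s ∣[0] γ = χ₈(d) • s` for `γ ∈ Γ₀(32)`. [cite: Savitt2025, Thm. 1] -/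
theorem etaQuotient_rS_slash {γ : SL(2, ℤ)} (hγ : γ ∈ Gamma0 32) :
    etaQuotient 32 rS ∣[(0 : ℤ)] γ = (ZMod.χ₈ ((γ 1 1 : ℤ) : ZMod 8) : ℂ) • etaQuotient 32 rS := by
  have hd : Odd (γ 1 1) := odd_d_of_mem_Gamma0_of_even (by decide) hγ
  have h := etaQuotient_slash_of_mem_Gamma0_char 32 (by norm_num) (by decide) rS 0 ⟨0, rfl⟩ rS_sum
    (by decide) (by decide) hγ
  rw [newmanChar_rS hd] at h
  exact h

/-- **Invariance on `Γ′ = ker (2/·)`**: if `γ ∈ Γ₀(32)` has `χ₈(d) = 1` (`d ≡ ±1 (mod 8)`) then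
`s(γτ) = s(τ)`. [cite: Savitt2025, Thm. 1] -/
theorem etaQuotient_rS_smul_of_chi_eq_one {γ : SL(2, ℤ)} (hγ : γ ∈ Gamma0 32)
    (hχ : ZMod.χ₈ ((γ 1 1 : ℤ) : ZMod 8) = 1) (τ : ℍ) :
    etaQuotient 32 rS (γ • τ) = etaQuotient 32 rS τ := by
  rw [etaQuotient_rS_smul hγ τ, hχ, Int.cast_one, one_mul]

/-- The other coset: if `γ ∈ Γ₀(32)` has `χ₈(d) = −1` (`d ≡ ±3 (mod 8)`) then `s(γτ) = −s(τ)`.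
[cite: Savitt2025, Thm. 1] -/
theorem etaQuotient_rS_smul_of_chi_eq_neg_one {γ : SL(2, ℤ)} (hγ : γ ∈ Gamma0 32)
    (hχ : ZMod.χ₈ ((γ 1 1 : ℤ) : ZMod 8) = -1) (τ : ℍ) :
    etaQuotient 32 rS (γ • τ) = -etaQuotient 32 rS τ := by
  rw [etaQuotient_rS_smul hγ τ, hχ, Int.cast_neg, Int.cast_one, neg_one_mul]

/-- `d ≡ 1 (mod 32)` forces `χ₈(d) = 1`. [folklore] -/
private theorem χ₈_eq_one_of_zmod32_eq_one {d : ℤ} (h : (d : ZMod 32) = 1) :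
    ZMod.χ₈ ((d : ℤ) : ZMod 8) = 1 := by
  have h8 : (d : ZMod 8) = 1 := by
    have hdvd : (32 : ℤ) ∣ d - 1 := by
      have := (ZMod.intCast_zmod_eq_zero_iff_dvd (d - 1) 32).mp (by push_cast; rw [h, sub_self])
      exact_mod_cast this
    have hdvd8 : (8 : ℤ) ∣ d - 1 := (show (8 : ℤ) ∣ 32 by norm_num).trans hdvd
    have := (ZMod.intCast_zmod_eq_zero_iff_dvd (d - 1) 8).mpr hdvd8
    push_cast at this
    exact sub_eq_zero.mp this
  rw [h8]
  decide

/-- **`s` is invariant under `Γ₁(32)`** (`d ≡ 1 (mod 32)` gives `χ₈(d) = 1`). [cite: Savitt2025, Thm. 1 (f is a form on Γ₁(N))] -/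
theorem etaQuotient_rS_smul_of_mem_Gamma1 {γ : SL(2, ℤ)} (hγ : γ ∈ Gamma1 32) (τ : ℍ) :
    etaQuotient 32 rS (γ • τ) = etaQuotient 32 rS τ := by
  have h := (Gamma1_mem 32 γ).mp hγ
  exact etaQuotient_rS_smul_of_chi_eq_one (Gamma1_in_Gamma0 32 hγ)
    (χ₈_eq_one_of_zmod32_eq_one h.2.1) τ

/-- **`s` is invariant under the principal congruence subgroup `Γ(32)`** — the invariance clause of
«`s` is a modular function of level `32`» (Cox §15.A (ii)). [cite: Savitt2025, Thm. 1 (f is a form on Γ₁(N) ⊇ Γ(N))] -/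
theorem etaQuotient_rS_smul_of_mem_Gamma {γ : SL(2, ℤ)} (hγ : γ ∈ CongruenceSubgroup.Gamma 32)
    (τ : ℍ) :
    etaQuotient 32 rS (γ • τ) = etaQuotient 32 rS τ := by
  have h := Gamma_mem.mp hγ
  exact etaQuotient_rS_smul_of_mem_Gamma1 ((Gamma1_mem 32 γ).mpr ⟨h.1, h.2.2.2, h.2.2.1⟩) τ

/-! ## Holomorphy, non-vanishing, leading term, orders at the cusps -/

/-- `s` is holomorphic on `ℍ`. [cite: Ligozat1975, Prop. 3.2.1] -/
theorem mdifferentiable_etaQuotient_rS : MDiff (etaQuotient 32 rS) := mdifferentiable_etaQuotient 32 rS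

/-- `s` has no zero on `ℍ` (its divisor on the level-`32` curve is cuspidal). [cite: Ligozat1975, Prop. 3.2.8] -/
theorem etaQuotient_rS_ne_zero (τ : ℍ) : etaQuotient 32 rS τ ≠ 0 := etaQuotient_ne_zero 32 rS τ

/-- **Leading term at `i∞`**: `s / q⁻¹ → 1`, i.e. `s = q⁻¹ + O(1)` (`q = e^{2πiτ}`): a simple pole at `∞`.
[cite: Ligozat1975, Prop. 3.2.8 (order at ∞ = Σ δ r_δ / 24)] -/
theorem tendsto_etaQuotient_rS :
    Tendsto (fun τ : ℍ ↦ etaQuotient 32 rS τ / Function.Periodic.qParam 1 τ ^ (-1 : ℤ)) atImInfty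
      (𝓝 1) :=
  tendsto_etaQuotient_div_qParam_zpow 32 rS (-1) (by rw [rS_sum_mul]; norm_num)

/-- The order of `s` at every cusp is `≥ −1` in the parameter `q`: `cuspOrder24 32 rS c ≥ −768 = −24·32`
for every `c ∈ ℤ` (it only depends on `gcd(32, c)`). [cite: Ligozat1975, Prop. 3.2.8] -/
theorem neg_le_cuspOrder24_rS (c : ℤ) : -768 ≤ cuspOrder24 32 rS c := by
  rw [cuspOrder24_eq_gcd]
  have hg : Nat.gcd 32 c.natAbs ∈ Nat.divisors 32 :=
    Nat.mem_divisors.mpr ⟨Nat.gcd_dvd_left _ _, by norm_num⟩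
  have h32 : Nat.divisors 32 = {1, 2, 4, 8, 16, 32} := by decide
  rw [h32] at hg
  simp only [Finset.mem_insert, Finset.mem_singleton] at hg
  obtain ⟨h1, h2, h4, h8, h16, h32'⟩ := cuspOrder24_rS
  rcases hg with h | h | h | h | h | h <;> rw [h] <;> push_cast <;> omega

/-! ## Meromorphy at the cusps: `qⁿ · (f ∣[k] γ)` is bounded when `24Nn + ord ≥ 0` -/

/-- **Meromorphy of `η`-quotients at every cusp, quantitatively**: for `f = ∏ η(δτ)^{r_δ}` with
`Σ r_δ = 2k`, `γ = (* *; c *) ∈ SL₂(ℤ)` and `n ∈ ℕ` with `24·N·n + cuspOrder24 N r c ≥ 0`, the function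
`q(τ)ⁿ · (f ∣[k] γ)(τ)` (`q = e^{2πiτ}`) is bounded at `i∞` — i.e. `f ∣[k] γ` has a pole of order at most
`n` in `q` at the cusp `γ·∞` (Savitt 2025, Rem. 2: the expansion of `f ∣ γ` starts with
`q^{(1/24) Σ gcd(c,δ)² r_δ/δ}`; the tree's exact size formula `exists_norm_sq_etaQuotient_slash`).
[cite: Savitt2025, Rem. 2] [cite: Ligozat1975, Prop. 3.2.8] -/
theorem isBoundedAtImInfty_qParam_pow_mul_etaQuotient_slash (N : ℕ) (hN : 0 < N) (r : ℕ → ℤ) (k : ℤ)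
    (hk : ∑ δ ∈ N.divisors, r δ = 2 * k) (γ : SL(2, ℤ)) (n : ℕ)
    (hord : 0 ≤ 24 * (N : ℤ) * n + cuspOrder24 N r (γ 1 0)) :
    IsBoundedAtImInfty
      (fun τ : ℍ ↦ Function.Periodic.qParam 1 τ ^ n * (etaQuotient N r ∣[k] (γ : GL (Fin 2) ℝ)) τ) := by
  obtain ⟨C, Q, hC, hQ, hformula⟩ := exists_norm_sq_etaQuotient_slash N hN r k hk γ
  have hQev : ∀ᶠ τ in atImInfty, Q τ ≤ 2 := (hQ.eventually (ge_mem_nhds (by norm_num)))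
  rw [IsBoundedAtImInfty, BoundedAtFilter, Asymptotics.isBigO_iff]
  refine ⟨Real.sqrt (C * 2), ?_⟩
  filter_upwards [hQev] with τ hQτ
  rw [Pi.one_apply, norm_one, mul_one]
  have hC0 : 0 ≤ C := hC.le
  have hN0 : (0 : ℝ) < N := by exact_mod_cast hN
  -- the size of `qⁿ · (f|γ)`, squared
  have hsq_formula : ‖Function.Periodic.qParam 1 (τ : ℂ) ^ n *
      (etaQuotient N r ∣[k] (γ : GL (Fin 2) ℝ)) τ‖ ^ 2 =
        C * Real.exp (-(π / (6 * N)) * ((24 * (N : ℤ) * n + cuspOrder24 N r (γ 1 0) : ℤ) : ℝ) * τ.im)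
          * Q τ := by
    rw [norm_mul, mul_pow, norm_pow, Function.Periodic.norm_qParam, UpperHalfPlane.coe_im, hformula τ,
      ← Real.exp_nat_mul, ← Real.exp_nat_mul]
    rw [show C * Real.exp (-(π / (6 * N)) * (cuspOrder24 N r (γ 1 0) : ℝ) * τ.im) * Q τ =
        Real.exp (-(π / (6 * N)) * (cuspOrder24 N r (γ 1 0) : ℝ) * τ.im) * (C * Q τ) by ring,
      ← mul_assoc, ← Real.exp_add]
    rw [show C * Real.exp (-(π / (6 * N)) * ((24 * (N : ℤ) * n + cuspOrder24 N r (γ 1 0) : ℤ) : ℝ) *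
        τ.im) * Q τ = Real.exp (-(π / (6 * N)) * ((24 * (N : ℤ) * n + cuspOrder24 N r (γ 1 0) : ℤ) : ℝ)
          * τ.im) * (C * Q τ) by ring]
    congr 2
    push_cast
    field_simp
    ring
  have hsq : ‖Function.Periodic.qParam 1 (τ : ℂ) ^ n *
      (etaQuotient N r ∣[k] (γ : GL (Fin 2) ℝ)) τ‖ ^ 2 ≤ C * 2 := by
    rw [hsq_formula]
    set E := Real.exp (-(π / (6 * N)) * ((24 * (N : ℤ) * n + cuspOrder24 N r (γ 1 0) : ℤ) : ℝ) * τ.im)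
      with hE_def
    have hE : E ≤ 1 := by
      rw [hE_def, Real.exp_le_one_iff]
      have h1 : (0 : ℝ) ≤ ((24 * (N : ℤ) * n + cuspOrder24 N r (γ 1 0) : ℤ) : ℝ) := by
        exact_mod_cast hord
      have h2 : 0 ≤ τ.im := τ.im_pos.le
      have : 0 ≤ π / (6 * N) * ((24 * (N : ℤ) * n + cuspOrder24 N r (γ 1 0) : ℤ) : ℝ) * τ.im := by
        positivity
      linarith
    have hCE : 0 < C * E := by positivity
    have hE0 : E ≠ 0 := (Real.exp_pos _).ne'
    have hQ0 : 0 ≤ Q τ := by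
      have h := hsq_formula
      have : Q τ = ‖Function.Periodic.qParam 1 (τ : ℂ) ^ n *
          (etaQuotient N r ∣[k] (γ : GL (Fin 2) ℝ)) τ‖ ^ 2 / (C * E) := by
        rw [h]; field_simp
      rw [this]
      positivity
    calc C * E * Q τ ≤ C * 1 * 2 := by gcongr
      _ = C * 2 := by ring
  calc ‖Function.Periodic.qParam 1 (τ : ℂ) ^ n * (etaQuotient N r ∣[k] (γ : GL (Fin 2) ℝ)) τ‖
      = Real.sqrt (‖Function.Periodic.qParam 1 (τ : ℂ) ^ n *
          (etaQuotient N r ∣[k] (γ : GL (Fin 2) ℝ)) τ‖ ^ 2) := (Real.sqrt_sq (norm_nonneg _)).symm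
    _ ≤ Real.sqrt (C * 2) := Real.sqrt_le_sqrt hsq

/-- **`s` is meromorphic at every cusp, with at most a simple pole in `q`**: for every `γ ∈ SL₂(ℤ)`,
`q(τ) · (s ∣[0] γ)(τ)` is bounded at `i∞` (`cuspOrder24 32 rS c ≥ −768 = −24·32`). This is the
«meromorphic at the cusps» clause of «`s` is a modular function of level `32`» (Cox §15.A (iii)).
[cite: Savitt2025, Rem. 2] [cite: Ligozat1975, Prop. 3.2.8] -/
theorem isBoundedAtImInfty_qParam_mul_etaQuotient_rS_slash (γ : SL(2, ℤ)) :
    IsBoundedAtImInfty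
      (fun τ : ℍ ↦ Function.Periodic.qParam 1 τ * (etaQuotient 32 rS ∣[(0 : ℤ)] (γ : GL (Fin 2) ℝ)) τ) := by
  have h := isBoundedAtImInfty_qParam_pow_mul_etaQuotient_slash 32 (by norm_num) rS 0 rS_sum γ 1
    (by have := neg_le_cuspOrder24_rS (γ 1 0); push_cast; omega)
  simpa only [pow_one] using h

/-- Without slash: `q(τ)·s(γτ)` is bounded at `i∞` for every `γ ∈ SL₂(ℤ)` (weight `0`: `s ∣[0] γ = s ∘ γ`).
[cite: Savitt2025, Rem. 2] -/
theorem isBoundedAtImInfty_qParam_mul_etaQuotient_rS_comp (γ : SL(2, ℤ)) :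
    IsBoundedAtImInfty (fun τ : ℍ ↦ Function.Periodic.qParam 1 τ * etaQuotient 32 rS (γ • τ)) := by
  have h := isBoundedAtImInfty_qParam_mul_etaQuotient_rS_slash γ
  refine h.congr' (Eventually.of_forall fun τ ↦ ?_) EventuallyEq.rfl
  beta_reduce
  rw [← SL_slash, SL_slash_apply, neg_zero, zpow_zero, mul_one]

/-! ## The integral `q`-expansion `q·s ∈ 1 + qℤ⟦q⟧` -/

/-- **`q·s(τ) = ∏_m (1 − q^{16m})³ (1 − q^{8m})⁻¹ (1 − q^{32m})⁻²`** — the Euler part of the `η`-quotient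
(`Σ δ r_δ = −24` makes the prefactor `q⁻¹`). [cite: Ligozat1975, Prop. 3.2.1] -/
theorem qParam_mul_etaQuotient_rS_eq_eulerUnit (τ : ℍ) :
    Function.Periodic.qParam 1 τ * etaQuotient 32 rS τ = eulerUnit 32 rS τ := by
  rw [etaQuotient_eq_cexp_mul_eulerUnit, rS_sum_mul, ← mul_assoc, Function.Periodic.qParam,
    ← Complex.exp_add, show 2 * π * I * (τ : ℂ) / (1 : ℝ) + 2 * π * I * τ / 24 * ((-24 : ℤ) : ℂ) = 0 by
      push_cast; ring, Complex.exp_zero, one_mul]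

/-- **`q·s` has an integral unit `q`-expansion**: it is `1`-periodic, holomorphic, bounded at `i∞`, and
Mathlib's `qExpansion 1 (q·s)` is the image of an integer power series with constant term `1`.
[cite: Ligozat1975, Prop. 3.2.1] -/
theorem isIntUnitQExp_qParam_mul_etaQuotient_rS :
    IsIntUnitQExp (fun τ : ℍ ↦ Function.Periodic.qParam 1 τ * etaQuotient 32 rS τ) := by
  rw [show (fun τ : ℍ ↦ Function.Periodic.qParam 1 τ * etaQuotient 32 rS τ) = eulerUnit 32 rS from
    funext qParam_mul_etaQuotient_rS_eq_eulerUnit]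
  exact isIntUnitQExp_eulerUnit 32 rS

/-- **The `q`-series of `s`**: `q·s(τ) = Σ_{m ≥ 0} a_m q(τ)^m` on all of `ℍ`, with `a = qExpansion 1 (q·s)`
the image of an integer series with `a₀ = 1` — so `s = q⁻¹ + a₁ + a₂ q + … ∈ q⁻¹ℤ⟦q⟧` has RATIONAL (indeed
integral) Fourier coefficients, the clause «coefficients in `ℚ(ζ₃₂)`» of `s ∈ F₃₂` (Cox §15.A).
[cite: Ligozat1975, Prop. 3.2.1] -/
theorem hasSum_qParam_mul_etaQuotient_rS (τ : ℍ) :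
    HasSum (fun m : ℕ ↦
        (qExpansion 1 (fun τ : ℍ ↦ Function.Periodic.qParam 1 τ * etaQuotient 32 rS τ)).coeff m •
          Function.Periodic.qParam 1 (τ : ℂ) ^ m)
      (Function.Periodic.qParam 1 τ * etaQuotient 32 rS τ) :=
  have h := isIntUnitQExp_qParam_mul_etaQuotient_rS
  hasSum_qExpansion one_pos h.periodic h.mdiff h.bdd τ

/-- The integer series behind the expansion: `∃ P ∈ ℤ⟦q⟧` with constant term `1` and
`P.map ℤ→ℂ = qExpansion 1 (q·s)`. [cite: Ligozat1975, Prop. 3.2.1] -/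
theorem exists_int_map_eq_qExpansion_qParam_mul_etaQuotient_rS :
    ∃ P : PowerSeries ℤ, PowerSeries.constantCoeff P = 1 ∧
      P.map (Int.castRingHom ℂ) =
        qExpansion 1 (fun τ : ℍ ↦ Function.Periodic.qParam 1 τ * etaQuotient 32 rS τ) :=
  isIntUnitQExp_qParam_mul_etaQuotient_rS.exists_int

end Literature.NumberTheory.EllipticCurves.ModularForms

end
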